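import Literature.Algebra.Lie.LefschetzModuleHyperinvariantExtremal
import HarnessLib

/-!
# The `ᶜΛ`-side of the hyperinvariant lattice: the Weyl operator `w` carries `Hinv(L)` onto `Hinv(ᶜΛ)`, the `ᶜΛ`-hyperinvariant
# subspaces are the BOTTOM staircases `⊕_k ⊕_{i ≤ k − j_k} LⁱP_{−k}`, `Ker ᶜΛᵃ` / `Im ᶜΛᵇ` in string coordinates, and the
# `ᶜΛ`-primitive vectors are the tops `LᵏP_{−k}` of the strings (André 1996 §1.2; Gohberg–Lancaster–Rodman §9.5–9.6)

[topic Algebra/Lie]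

Topic `Literature/Algebra/Lie` (namespace `Literature.Algebra.Lie.HasLefschetzProperty`), lane `lit-hodgefound` (Track 2 foundations
library; prover seat `lit-hodgefound-p34`, generation 46, row g46-#10 — the generation's free pointer (ii) "the `f`-side by symmetry").
THEOREMS ONLY (no definition, no instance, no notation, no named fact; net debt `0`).  Sequel of the seat's
`LefschetzModuleHyperinvariantSubspaces` (`Hinv(e)` = the staircases `S(j) = ⊕_k ⊕_{i ≥ j_k} eⁱP_{−k}`, `j` admissible; `Ker eᵃ = S(k ↦ k+1−a)`,
`Im eᵇ = S(k ↦ b)`), `LefschetzModuleHyperinvariantExtremal` and `LefschetzModuleWeylOperator` (André's Weyl operator `w = exp(ᶜΛ)exp(−L)exp(ᶜΛ)`: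
`w L = −ᶜΛ w`, `w h = −h w`, `w⁴ = 1`, `w(eʲp) = ±(j!/(k−j)!)·e^{k−j}p` on the strings).

THE MATHEMATICS.  Let `(M, h, e)` be a Lefschetz module over a field of characteristic `0`, `f = ᶜΛ = L.dual hgr` its lowering partner and
`w` the Weyl operator.  Since `w` is invertible with `w e w⁻¹ = −f` (§1–§2), conjugation by `w` is an algebra automorphism of `End(M)` carrying the
commutant `{e}'` onto `{−f}' = {f}'`; hence **a subspace `U` is `e`-hyperinvariant iff `w(U)` is `f`-hyperinvariant** (`hyperinvariant_dual_map_weylOperator_iff`),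
and `U ↦ w(U)` is a bijection `Hinv(e) → Hinv(f)` (`ncard_setOf_hyperinvariant_dual`).  On the strings `w` is the REVERSAL `eⁱP_{−k} ↦ e^{k−i}P_{−k}`
(§3, the scalar `±i!/(k−i)!` being non-zero in characteristic `0`), so `w` maps the top staircase `S(j) = ⊕_k ⊕_{i ≥ j_k} eⁱP_{−k}` onto the BOTTOM
staircase `S_↓(j) = ⊕_k ⊕_{i ≤ k−j_k} eⁱP_{−k}` (`map_weylOperator_iSup_map_pow_primitiveSpace`) and (§4) **the `f`-hyperinvariant subspaces of `M`
are exactly the bottom staircases `S_↓(j)`, `j` admissible** (`hyperinvariant_dual_iff_exists` — the mirror image of Gohberg–Lancaster–Rodman's Lemma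
9.5.2 for the lowering operator, whose strings run downwards); in particular (§5) **`Ker ᶜΛᵃ = w(Ker Lᵃ) = ⊕_k ⊕_{i < a} eⁱP_{−k}`** (the bottom `a`
positions of every string; `a = 1`: `Ker ᶜΛ = ⊕_k P_{−k}`, Beauville's "the primitive elements are exactly the lowest weight elements") and
**`Im ᶜΛᵇ = w(Im Lᵇ) = ⊕_k ⊕_{i ≤ k−b} eⁱP_{−k}`**.  Finally (§6) the Weyl operator realises the symmetry `(h, e) ↦ (−h, −f)` of Lefschetz pairs:
`w h w⁻¹ = −h`, `w e w⁻¹ = −f`, so **the `f`-primitive subspaces (for the reversed grading `−h`) are the images `w(P_{−k}) = eᵏP_{−k}`, the TOPS of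
the strings**: `primitiveSpace (−h) ᶜΛ k = eᵏP_{−k} = M_k ∩ Ker e` (`primitiveSpace_neg_dual_eq_map_pow`).

## References
* [Andre1996Motifs] Y. André, *Pour une théorie inconditionnelle des motifs*, Publ. Math. IHÉS 83 (1996), §1.2 (p. 11: the `𝔰𝔩₂`-triplet
  `(ᶜΛ, h, −L)`, "l'élément `(0 1 ; −1 0)` de `SL₂` s'envoie sur `± *_H`") — the Weyl operator (through `LefschetzModuleWeylOperator`).
* [GohbergLancasterRodman2006] I. Gohberg, P. Lancaster, L. Rodman, *Invariant Subspaces of Matrices with Applications*, SIAM Classics 51,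
  Prop. 9.5.1 (p0275: `Ker(A − λI)ᵏ`, `Im(A − λI)ᵏ` are hyperinvariant), **Lemma 9.5.2** (p0276: the hyperinvariant subspaces of a nilpotent `B` are
  the `𝒦¹_{q_1} ∔ ⋯ ∔ 𝒦^m_{q_m}`, `(q_i) ∈ Λ(p_1, …, p_m)`), Thm. 9.6.1 (p0278: `Hinv(A)` is a finite self-dual distributive lattice) — here for the
  LOWERING nilpotent `ᶜΛ`, whose Jordan chains are the strings read downwards.
* [Kaplansky1954] I. Kaplansky, *Infinite Abelian Groups*, §18 Theorem 25 (p0065: fully invariant submodules `⟺` height inequalities) and Notes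
  (p0091: "Substitute 'principal ideal ring' at will").
* [Beauville2010SL2] A. Beauville, *The action of SL₂ on abelian varieties*, J. Ramanujan Math. Soc. 25 (2010), §5 ("the primitive elements are
  exactly the lowest weight elements for the action of SL₂"; through `LefschetzModuleLowestWeightVectors`).
* [LooijengaLunts1997] E. Looijenga, V. A. Lunts, *A Lie algebra attached to a projective variety*, Invent. Math. 129 (1997), §1 (1.1)–(1.6)
  (Lefschetz modules, `P_{−k}`, the strings `ℂ[e]P_{−k}`).

## Main statements (`S(j) := ⨆ k, ⨆ i, ⨆ (_ : j k ≤ i), (primitiveSpace h e k).map (e ^ i)`, `S_↓(j) := ⨆ k, ⨆ i, ⨆ (_ : i + j k ≤ k),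
(primitiveSpace h e k).map (e ^ i)`; "`U` hyperinvariant for `a`" is `∀ T, Commute a T → ∀ x ∈ U, T x ∈ U`; `w = L.weylOperator hgr`, `f = L.dual hgr`)
* §1 ★ `hyperinvariant_map_of_units_semiconj` / `hyperinvariant_map_iff_of_units_semiconj` (transport of hyperinvariance under a unit `u` with
  `u e = e₂ u`: `Hinv_{e₂}(uU) ⟺ Hinv_e(U)`; any operators).
* §2 `pow_three_mul_weylOperator` (`w³·w = 1`; `w·w³ = 1` is `LefschetzModuleSL2Representation.weylOperator_mul_weylOperator_pow_three`), `isUnit_weylOperator`, `weylOperator_injective`, ★★★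
  **`hyperinvariant_dual_map_weylOperator_iff`** (`w(U)` is `ᶜΛ`-hyperinvariant iff `U` is `L`-hyperinvariant), `map_weylOperator_pow_three_map_weylOperator`
  (`w(w³U) = U`).
* §3 ★★ `map_weylOperator_map_pow_primitiveSpace` (`w(eⁱP_{−k}) = e^{k−i}P_{−k}`), ★★ `map_weylOperator_iSup_map_pow_primitiveSpace` (`w(S(j)) = S_↓(j)`).
* §4 ★★★ **`hyperinvariant_dual_iff_exists`** (THE `ᶜΛ`-HYPERINVARIANT SUBSPACES ARE THE BOTTOM STAIRCASES `S_↓(j)`, `j` normalised and admissible),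
  ★ `hyperinvariant_dual_iSup_of_admissible` (every admissible bottom staircase is `ᶜΛ`-hyperinvariant), ★★ `ncard_setOf_hyperinvariant_dual`
  (`|Hinv(ᶜΛ)| = |Hinv(L)|`).
* §5 `weylOperator_mul_pow` (`w eᵃ = (−ᶜΛ)ᵃ w`), ★★ `map_weylOperator_ker_pow` / `map_weylOperator_range_pow` (`w(Ker eᵃ) = Ker ᶜΛᵃ`, `w(Im eᵇ) = Im ᶜΛᵇ`), ★★
  **`ker_dual_pow_eq_iSup`** (`Ker ᶜΛᵃ = ⊕_k ⊕_{i+(k+1−a) ≤ k} eⁱP_{−k}`), ★★ **`range_dual_pow_eq_iSup`** (`Im ᶜΛᵇ = ⊕_k ⊕_{i+b ≤ k} eⁱP_{−k}`).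
* §6 ★ `weylOperator_conj_h` / `weylOperator_conj_e` (`w h w³ = −h`, `w e w³ = −f`), ★★★
  **`primitiveSpace_neg_dual_eq_map_pow`** (`primitiveSpace (−h) ᶜΛ k = eᵏP_{−k}`: the `ᶜΛ`-primitives are the tops of the strings), ★
  `primitiveSpace_neg_dual_eq_degreeSpace_inf_ker` (`= M_k ∩ Ker e`).
-/

namespace Literature.Algebra.Lie

open Module Function Set

variable {K : Type*} [Field K] [CharZero K] {M : Type*} [AddCommGroup M] [Module K M] [FiniteDimensional K M]
  {h e : Module.End K M}

namespace HasLefschetzProperty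

/-! ## §1 Transport of hyperinvariance under a unit `u` with `u e = e₂ u` -/

omit [CharZero K] [FiniteDimensional K M] in
/-- If `u` is invertible with `u e = e₂ u` and `U` is `e`-hyperinvariant, then `u(U)` is `e₂`-hyperinvariant (`T ↦ u⁻¹Tu` maps `{e₂}'` onto `{e}'`).
[cite: GohbergLancasterRodman2006, §9.4 (p0273: hyperinvariance is a similarity invariant)] [cite: Kaplansky1954, §18 p0060] -/
theorem hyperinvariant_map_of_units_semiconj {e e₂ : Module.End K M} (u : (Module.End K M)ˣ) (hu : (u : Module.End K M) * e = e₂ * u)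
    {U : Submodule K M} (hU : ∀ T : Module.End K M, Commute e T → ∀ x ∈ U, T x ∈ U) :
    ∀ T : Module.End K M, Commute e₂ T → ∀ x ∈ U.map (u : Module.End K M), T x ∈ U.map (u : Module.End K M) := by
  intro T hT x hx
  obtain ⟨y, hy, rfl⟩ := Submodule.mem_map.1 hx
  have he : e = ↑u⁻¹ * e₂ * ↑u := by rw [mul_assoc, ← hu, ← mul_assoc, Units.inv_mul, one_mul]
  -- `u⁻¹ T u` commutes with `e = u⁻¹ e₂ u`
  have hc : Commute e (↑u⁻¹ * T * ↑u) := by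
    rw [he]
    show ↑u⁻¹ * e₂ * ↑u * (↑u⁻¹ * T * ↑u) = ↑u⁻¹ * T * ↑u * (↑u⁻¹ * e₂ * ↑u)
    simp only [mul_assoc, Units.mul_inv_cancel_left]
    rw [← mul_assoc e₂ T, hT.eq, mul_assoc]
  have h2 : T ((u : Module.End K M) y) = (u : Module.End K M) ((↑u⁻¹ * T * ↑u) y) := by
    rw [Module.End.mul_apply, Module.End.mul_apply, ← Module.End.mul_apply (↑u : Module.End K M) ↑u⁻¹ (T ((u : Module.End K M) y)),
      Units.mul_inv, Module.End.one_apply]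
  rw [h2]
  exact Submodule.mem_map_of_mem (hU _ hc y hy)

omit [CharZero K] [FiniteDimensional K M] in
/-- **`u(U)` is `e₂`-hyperinvariant iff `U` is `e`-hyperinvariant**, for a unit `u` with `u e = e₂ u` (conjugation by `u` is an algebra automorphism of
`End(M)` carrying `{e}'` onto `{e₂}'`). [cite: GohbergLancasterRodman2006, §9.4 (p0273)] [cite: Kaplansky1954, §18 p0060] -/
theorem hyperinvariant_map_iff_of_units_semiconj {e e₂ : Module.End K M} (u : (Module.End K M)ˣ) (hu : (u : Module.End K M) * e = e₂ * u)
    (U : Submodule K M) :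
    (∀ T : Module.End K M, Commute e₂ T → ∀ x ∈ U.map (u : Module.End K M), T x ∈ U.map (u : Module.End K M)) ↔
      ∀ T : Module.End K M, Commute e T → ∀ x ∈ U, T x ∈ U := by
  refine ⟨fun hU ↦ ?_, hyperinvariant_map_of_units_semiconj u hu⟩
  have he₂ : e₂ = ↑u * e * ↑u⁻¹ := by rw [hu, mul_assoc, Units.mul_inv, mul_one]
  have hu' : (↑u⁻¹ : Module.End K M) * e₂ = e * ↑u⁻¹ := by
    rw [he₂, ← mul_assoc, ← mul_assoc, Units.inv_mul, one_mul]
  have h1 := hyperinvariant_map_of_units_semiconj u⁻¹ hu' hU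
  rwa [← Submodule.map_comp, ← Module.End.mul_eq_comp, Units.inv_mul, Module.End.one_eq_id, Submodule.map_id] at h1

/-! ## §2 The Weyl operator is a unit conjugating `L` into `−ᶜΛ` -/

/-- `w³ · w = 1`. [cite: Andre1996Motifs, §1.2 (p. 11)] -/
theorem pow_three_mul_weylOperator (L : HasLefschetzProperty h e) (hgr : IsZGrading h) :
    L.weylOperator hgr ^ 3 * L.weylOperator hgr = 1 := by
  rw [← pow_succ, L.weylOperator_pow_four hgr]

/-- The Weyl operator is invertible (`w⁴ = 1`). [cite: Andre1996Motifs, §1.2 (p. 11)] -/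
theorem isUnit_weylOperator (L : HasLefschetzProperty h e) (hgr : IsZGrading h) : IsUnit (L.weylOperator hgr) :=
  ⟨⟨L.weylOperator hgr, L.weylOperator hgr ^ 3, L.weylOperator_mul_weylOperator_pow_three hgr, L.pow_three_mul_weylOperator hgr⟩, rfl⟩

/-- The Weyl operator is injective. [cite: Andre1996Motifs, §1.2 (p. 11)] -/
theorem weylOperator_injective (L : HasLefschetzProperty h e) (hgr : IsZGrading h) : Function.Injective (L.weylOperator hgr) :=
  LinearMap.ker_eq_bot.1 ((LinearMap.isUnit_iff_ker_eq_bot _).1 (L.isUnit_weylOperator hgr))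

/-- `w(w³U) = U`. [cite: Andre1996Motifs, §1.2 (p. 11)] -/
theorem map_weylOperator_pow_three_map_weylOperator (L : HasLefschetzProperty h e) (hgr : IsZGrading h) (U : Submodule K M) :
    (U.map (L.weylOperator hgr ^ 3)).map (L.weylOperator hgr) = U := by
  rw [← Submodule.map_comp, ← Module.End.mul_eq_comp, L.weylOperator_mul_weylOperator_pow_three hgr, Module.End.one_eq_id, Submodule.map_id]

/-- **`w(U)` IS `ᶜΛ`-HYPERINVARIANT IFF `U` IS `L`-HYPERINVARIANT**: the Weyl operator carries the lattice `Hinv(L)` onto `Hinv(ᶜΛ)` (`w e w⁻¹ = −ᶜΛ`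
and `{−ᶜΛ}' = {ᶜΛ}'`). [cite: Andre1996Motifs, §1.2 (p. 11: "(ᶜΛ, h, −L) forme un 𝔰𝔩₂-triplet")] [cite: GohbergLancasterRodman2006, §9.4 (p0273)] -/
theorem hyperinvariant_dual_map_weylOperator_iff (L : HasLefschetzProperty h e) (hgr : IsZGrading h) (U : Submodule K M) :
    (∀ T : Module.End K M, Commute (L.dual hgr) T → ∀ x ∈ U.map (L.weylOperator hgr), T x ∈ U.map (L.weylOperator hgr)) ↔
      ∀ T : Module.End K M, Commute e T → ∀ x ∈ U, T x ∈ U := by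
  let u : (Module.End K M)ˣ := ⟨L.weylOperator hgr, L.weylOperator hgr ^ 3, L.weylOperator_mul_weylOperator_pow_three hgr, L.pow_three_mul_weylOperator hgr⟩
  have hu : (u : Module.End K M) * e = (-L.dual hgr) * u := by
    show L.weylOperator hgr * e = -L.dual hgr * L.weylOperator hgr
    rw [L.weylOperator_mul_e hgr, neg_mul]
  have h1 := hyperinvariant_map_iff_of_units_semiconj u hu U
  simp only [Commute.neg_left_iff] at h1
  exact h1

/-! ## §3 The Weyl operator reverses the strings: `w(eⁱP_{−k}) = e^{k−i}P_{−k}`, `w(S(j)) = S_↓(j)` -/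

/-- **`w(eⁱP_{−k}) = e^{k−i}P_{−k}`** (`i ≤ k`): `w(eⁱp) = ±(i!/(k−i)!)·e^{k−i}p` with a non-zero scalar. [cite: Andre1996Motifs, §1.2 (p. 11) and §1.1
(p. 10: the factor k!/(d−j+k)!)] -/
theorem map_weylOperator_map_pow_primitiveSpace (L : HasLefschetzProperty h e) (hgr : IsZGrading h) {k i : ℕ} (hik : i ≤ k) :
    ((primitiveSpace h e k).map (e ^ i)).map (L.weylOperator hgr) = (primitiveSpace h e k).map (e ^ (k - i)) := by
  have hc : ((-1 : K) ^ (k + i) * ((Nat.factorial i : ℕ) : K) * (((Nat.factorial (k - i) : ℕ) : K))⁻¹) ≠ 0 :=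
    mul_ne_zero (mul_ne_zero (pow_ne_zero _ (neg_ne_zero.2 one_ne_zero)) (Nat.cast_ne_zero.2 (Nat.factorial_ne_zero _)))
      (inv_ne_zero (Nat.cast_ne_zero.2 (Nat.factorial_ne_zero _)))
  apply le_antisymm
  · rintro _ ⟨_, ⟨p, hp, rfl⟩, rfl⟩
    rw [L.weylOperator_apply_pow_primitive hgr hp hik]
    exact Submodule.smul_mem _ _ (Submodule.mem_map_of_mem hp)
  · rintro _ ⟨p, hp, rfl⟩
    refine ⟨(e ^ i) (((-1 : K) ^ (k + i) * ((Nat.factorial i : ℕ) : K) * (((Nat.factorial (k - i) : ℕ) : K))⁻¹)⁻¹ • p),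
      Submodule.mem_map_of_mem (Submodule.smul_mem _ _ hp), ?_⟩
    rw [map_smul, map_smul, L.weylOperator_apply_pow_primitive hgr hp hik, smul_smul, inv_mul_cancel₀ hc, one_smul]

/-- **`w(S(j)) = S_↓(j)`**: the Weyl operator maps the top staircase `⊕_k ⊕_{i ≥ j_k} eⁱP_{−k}` onto the bottom staircase `⊕_k ⊕_{i ≤ k−j_k} eⁱP_{−k}`.
[cite: Andre1996Motifs, §1.2 (p. 11)] [cite: GohbergLancasterRodman2006, Thm. 9.6.1 proof (p0279: the self-duality ψ(𝒦_q) = 𝒦_{p−q})] -/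
theorem map_weylOperator_iSup_map_pow_primitiveSpace (L : HasLefschetzProperty h e) (hgr : IsZGrading h) (j : ℕ → ℕ) :
    (⨆ k : ℕ, ⨆ i : ℕ, ⨆ (_ : j k ≤ i), (primitiveSpace h e k).map (e ^ i)).map (L.weylOperator hgr) =
      ⨆ k : ℕ, ⨆ i : ℕ, ⨆ (_ : i + j k ≤ k), (primitiveSpace h e k).map (e ^ i) := by
  simp only [Submodule.map_iSup]
  apply le_antisymm
  · refine iSup_le fun k ↦ iSup_le fun i ↦ iSup_le fun hi ↦ ?_
    rcases le_or_gt i k with hik | hki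
    · rw [L.map_weylOperator_map_pow_primitiveSpace hgr hik]
      exact le_iSup_of_le k (le_iSup_of_le (k - i) (le_iSup_of_le (by omega) le_rfl))
    · rw [map_pow_primitiveSpace_eq_bot_of_lt hki, Submodule.map_bot]
      exact bot_le
  · refine iSup_le fun k ↦ iSup_le fun i ↦ iSup_le fun hi ↦ ?_
    have h1 := L.map_weylOperator_map_pow_primitiveSpace hgr (Nat.sub_le k i)
    rw [show k - (k - i) = i by omega] at h1
    rw [← h1]
    exact le_iSup_of_le k (le_iSup_of_le (k - i) (le_iSup_of_le (by omega) le_rfl))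

/-! ## §4 The `ᶜΛ`-hyperinvariant subspaces are the bottom staircases -/

/-- **THE `ᶜΛ`-HYPERINVARIANT SUBSPACES OF A LEFSCHETZ MODULE ARE THE BOTTOM STAIRCASES `S_↓(j) = ⊕_k ⊕_{i ≤ k−j_k} eⁱP_{−k}`**, `j` normalised
(`j_k ≤ k + 1`) and admissible (`j_k ≤ j_{k'} ≤ j_k + (k' − k)` on the string types `k ≤ k'`) — Gohberg–Lancaster–Rodman's Lemma 9.5.2 for the
LOWERING nilpotent `ᶜΛ`, whose Jordan chains are the strings read from the top: a `ᶜΛ`-hyperinvariant subspace keeps, in every string, a BOTTOM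
segment. [cite: GohbergLancasterRodman2006, Lemma 9.5.2 (p0276), Thm. 9.4.2 (p0274)] [cite: Andre1996Motifs, §1.2 (p. 11)] [cite: Kaplansky1954, §18
Theorem 25 (p0065)] -/
theorem hyperinvariant_dual_iff_exists (L : HasLefschetzProperty h e) (hgr : IsZGrading h) (U : Submodule K M) :
    (∀ T : Module.End K M, Commute (L.dual hgr) T → ∀ x ∈ U, T x ∈ U) ↔
      ∃ j : ℕ → ℕ, (∀ k, j k ≤ k + 1) ∧
        (∀ k k' : ℕ, k ≤ k' → primitiveSpace h e k ≠ ⊥ → primitiveSpace h e k' ≠ ⊥ → j k ≤ j k' ∧ j k' ≤ j k + (k' - k)) ∧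
        U = ⨆ k : ℕ, ⨆ i : ℕ, ⨆ (_ : i + j k ≤ k), (primitiveSpace h e k).map (e ^ i) := by
  have hU := (L.map_weylOperator_pow_three_map_weylOperator hgr U).symm
  rw [hU, L.hyperinvariant_dual_map_weylOperator_iff hgr, L.hyperinvariant_iff_exists hgr]
  refine exists_congr fun j ↦ and_congr_right fun _ ↦ and_congr_right fun _ ↦ ?_
  rw [← L.map_weylOperator_iSup_map_pow_primitiveSpace hgr j]
  exact ⟨fun h1 ↦ by rw [h1], fun h1 ↦ Submodule.map_injective_of_injective (L.weylOperator_injective hgr) h1⟩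

/-- **Every admissible bottom staircase is `ᶜΛ`-hyperinvariant.** [cite: GohbergLancasterRodman2006, Lemma 9.5.2 (p0276)] [cite: Andre1996Motifs, §1.2 (p. 11)] -/
theorem hyperinvariant_dual_iSup_of_admissible (L : HasLefschetzProperty h e) (hgr : IsZGrading h) (j : ℕ → ℕ)
    (hadm : ∀ k k' : ℕ, k ≤ k' → primitiveSpace h e k ≠ ⊥ → primitiveSpace h e k' ≠ ⊥ → j k ≤ j k' ∧ j k' ≤ j k + (k' - k)) :
    ∀ T : Module.End K M, Commute (L.dual hgr) T →
      ∀ x ∈ ⨆ k : ℕ, ⨆ i : ℕ, ⨆ (_ : i + j k ≤ k), (primitiveSpace h e k).map (e ^ i),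
        T x ∈ ⨆ k : ℕ, ⨆ i : ℕ, ⨆ (_ : i + j k ≤ k), (primitiveSpace h e k).map (e ^ i) := by
  rw [← L.map_weylOperator_iSup_map_pow_primitiveSpace hgr j, L.hyperinvariant_dual_map_weylOperator_iff hgr]
  exact fun T hT x hx ↦ L.apply_mem_iSup_map_pow_primitiveSpace_of_commute hgr j hadm hT hx

/-- **`|Hinv(ᶜΛ)| = |Hinv(L)|`**: `U ↦ w(U)` is a bijection from the `L`-hyperinvariant onto the `ᶜΛ`-hyperinvariant subspaces. [cite:
GohbergLancasterRodman2006, Thm. 9.6.1 (p0278: the count depends only on the Jordan structure)] [cite: Andre1996Motifs, §1.2 (p. 11)] -/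
theorem ncard_setOf_hyperinvariant_dual (L : HasLefschetzProperty h e) (hgr : IsZGrading h) :
    Set.ncard {U : Submodule K M | ∀ T : Module.End K M, Commute (L.dual hgr) T → ∀ x ∈ U, T x ∈ U} =
      Set.ncard {U : Submodule K M | ∀ T : Module.End K M, Commute e T → ∀ x ∈ U, T x ∈ U} := by
  have himage : {U : Submodule K M | ∀ T : Module.End K M, Commute (L.dual hgr) T → ∀ x ∈ U, T x ∈ U} =
      (fun U : Submodule K M ↦ U.map (L.weylOperator hgr)) '' {U : Submodule K M | ∀ T : Module.End K M, Commute e T → ∀ x ∈ U, T x ∈ U} := by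
    ext V
    simp only [Set.mem_setOf_eq, Set.mem_image]
    constructor
    · intro hV
      refine ⟨V.map (L.weylOperator hgr ^ 3), ?_, L.map_weylOperator_pow_three_map_weylOperator hgr V⟩
      rw [← L.hyperinvariant_dual_map_weylOperator_iff hgr, L.map_weylOperator_pow_three_map_weylOperator hgr]
      exact hV
    · rintro ⟨U, hU, rfl⟩
      exact (L.hyperinvariant_dual_map_weylOperator_iff hgr U).2 hU
  rw [himage, Set.ncard_image_of_injective _ (Submodule.map_injective_of_injective (L.weylOperator_injective hgr))]

/-! ## §5 `Ker ᶜΛᵃ` and `Im ᶜΛᵇ` in string coordinates -/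

omit [CharZero K] [FiniteDimensional K M] in
/-- `Ker (−a)ⁿ = Ker aⁿ`. [folklore] -/
private theorem ker_neg_pow (a : Module.End K M) (n : ℕ) : LinearMap.ker ((-a) ^ n) = LinearMap.ker (a ^ n) := by
  rcases neg_one_pow_eq_or (Module.End K M) n with h1 | h1 <;> rw [neg_pow, h1]
  · rw [one_mul]
  · rw [neg_one_mul, LinearMap.ker_neg]

omit [CharZero K] [FiniteDimensional K M] in
/-- `Im (−a)ⁿ = Im aⁿ`. [folklore] -/
private theorem range_neg_pow (a : Module.End K M) (n : ℕ) : LinearMap.range ((-a) ^ n) = LinearMap.range (a ^ n) := by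
  rcases neg_one_pow_eq_or (Module.End K M) n with h1 | h1 <;> rw [neg_pow, h1]
  · rw [one_mul]
  · rw [neg_one_mul, LinearMap.range_neg]

/-- `w eᵃ = (−ᶜΛ)ᵃ w`. [cite: Andre1996Motifs, §1.2 (p. 11)] -/
theorem weylOperator_mul_pow (L : HasLefschetzProperty h e) (hgr : IsZGrading h) (a : ℕ) :
    L.weylOperator hgr * e ^ a = (-L.dual hgr) ^ a * L.weylOperator hgr := by
  have h1 : SemiconjBy (L.weylOperator hgr) e (-L.dual hgr) := by
    show L.weylOperator hgr * e = -L.dual hgr * L.weylOperator hgr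
    rw [L.weylOperator_mul_e hgr, neg_mul]
  exact (h1.pow_right a).eq

/-- **`w(Ker Lᵃ) = Ker ᶜΛᵃ`.** [cite: Andre1996Motifs, §1.2 (p. 11)] [cite: GohbergLancasterRodman2006, Prop. 9.5.1 (p0275)] -/
theorem map_weylOperator_ker_pow (L : HasLefschetzProperty h e) (hgr : IsZGrading h) (a : ℕ) :
    (LinearMap.ker (e ^ a)).map (L.weylOperator hgr) = LinearMap.ker (L.dual hgr ^ a) := by
  rw [← ker_neg_pow (L.dual hgr) a]
  apply le_antisymm
  · rintro _ ⟨x, hx, rfl⟩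
    rw [SetLike.mem_coe, LinearMap.mem_ker] at hx
    rw [LinearMap.mem_ker, ← Module.End.mul_apply, ← L.weylOperator_mul_pow hgr a, Module.End.mul_apply, hx, map_zero]
  · intro y hy
    rw [LinearMap.mem_ker] at hy
    refine ⟨(L.weylOperator hgr ^ 3) y, ?_, ?_⟩
    · rw [SetLike.mem_coe, LinearMap.mem_ker]
      apply L.weylOperator_injective hgr
      rw [map_zero, ← Module.End.mul_apply, ← Module.End.mul_apply, L.weylOperator_mul_pow hgr a, mul_assoc,
        L.weylOperator_mul_weylOperator_pow_three hgr, mul_one, hy]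
    · rw [← Module.End.mul_apply, L.weylOperator_mul_weylOperator_pow_three hgr, Module.End.one_apply]

/-- **`w(Im Lᵇ) = Im ᶜΛᵇ`.** [cite: Andre1996Motifs, §1.2 (p. 11)] [cite: GohbergLancasterRodman2006, Prop. 9.5.1 (p0275)] -/
theorem map_weylOperator_range_pow (L : HasLefschetzProperty h e) (hgr : IsZGrading h) (b : ℕ) :
    (LinearMap.range (e ^ b)).map (L.weylOperator hgr) = LinearMap.range (L.dual hgr ^ b) := by
  rw [← range_neg_pow (L.dual hgr) b]
  apply le_antisymm
  · rintro _ ⟨_, ⟨x, rfl⟩, rfl⟩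
    rw [← Module.End.mul_apply, L.weylOperator_mul_pow hgr b, Module.End.mul_apply]
    exact LinearMap.mem_range_self _ _
  · rintro _ ⟨z, rfl⟩
    refine ⟨(e ^ b) ((L.weylOperator hgr ^ 3) z), LinearMap.mem_range_self _ _, ?_⟩
    rw [← Module.End.mul_apply, ← Module.End.mul_apply, L.weylOperator_mul_pow hgr b, mul_assoc, L.weylOperator_mul_weylOperator_pow_three hgr, mul_one]

/-- **`Ker ᶜΛᵃ = ⊕_k ⊕_{i + (k+1−a) ≤ k} eⁱP_{−k}`** — the bottom `a` positions of every string (`a = 1`: `Ker ᶜΛ = ⊕_k P_{−k}`, the lowest weight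
vectors). [cite: Beauville2010SL2, §5] [cite: GohbergLancasterRodman2006, (9.5.7) (p0278)] [cite: Andre1996Motifs, §1.2 (p. 11)] -/
theorem ker_dual_pow_eq_iSup (L : HasLefschetzProperty h e) (hgr : IsZGrading h) (a : ℕ) :
    LinearMap.ker (L.dual hgr ^ a) = ⨆ k : ℕ, ⨆ i : ℕ, ⨆ (_ : i + (k + 1 - a) ≤ k), (primitiveSpace h e k).map (e ^ i) := by
  rw [← L.map_weylOperator_ker_pow hgr a, L.ker_pow_eq_iSup_map_pow_primitiveSpace hgr a, L.map_weylOperator_iSup_map_pow_primitiveSpace hgr]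

/-- **`Im ᶜΛᵇ = ⊕_k ⊕_{i + b ≤ k} eⁱP_{−k}`** — everything but the top `b` positions of every string. [cite: GohbergLancasterRodman2006, (9.5.7) (p0278)]
[cite: Andre1996Motifs, §1.2 (p. 11)] -/
theorem range_dual_pow_eq_iSup (L : HasLefschetzProperty h e) (hgr : IsZGrading h) (b : ℕ) :
    LinearMap.range (L.dual hgr ^ b) = ⨆ k : ℕ, ⨆ i : ℕ, ⨆ (_ : i + b ≤ k), (primitiveSpace h e k).map (e ^ i) := by
  rw [← L.map_weylOperator_range_pow hgr b, L.range_pow_eq_iSup_map_pow_primitiveSpace hgr b, L.map_weylOperator_iSup_map_pow_primitiveSpace hgr]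

/-! ## §6 The `ᶜΛ`-primitive vectors are the tops of the strings -/

/-- `w h w³ = −h` (as a conjugate under the linear equivalence `w`). [cite: Andre1996Motifs, §1.2 (p. 11: w h = −h w)] -/
theorem weylOperator_conj_h (L : HasLefschetzProperty h e) (hgr : IsZGrading h) :
    (LinearEquiv.ofLinear (L.weylOperator hgr) (L.weylOperator hgr ^ 3) (L.weylOperator_mul_weylOperator_pow_three hgr) (L.pow_three_mul_weylOperator hgr)).conj h
      = -h := by
  rw [LinearEquiv.conj_apply, LinearEquiv.ofLinear_toLinearMap, LinearEquiv.ofLinear_symm_toLinearMap, ← Module.End.mul_eq_comp,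
    ← Module.End.mul_eq_comp, L.weylOperator_mul_h hgr, neg_mul, mul_assoc, L.weylOperator_mul_weylOperator_pow_three hgr, mul_one]

/-- `w e w³ = −ᶜΛ`. [cite: Andre1996Motifs, §1.2 (p. 11: w L = −ᶜΛ w)] -/
theorem weylOperator_conj_e (L : HasLefschetzProperty h e) (hgr : IsZGrading h) :
    (LinearEquiv.ofLinear (L.weylOperator hgr) (L.weylOperator hgr ^ 3) (L.weylOperator_mul_weylOperator_pow_three hgr) (L.pow_three_mul_weylOperator hgr)).conj e
      = -L.dual hgr := by
  rw [LinearEquiv.conj_apply, LinearEquiv.ofLinear_toLinearMap, LinearEquiv.ofLinear_symm_toLinearMap, ← Module.End.mul_eq_comp,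
    ← Module.End.mul_eq_comp, L.weylOperator_mul_e hgr, neg_mul, mul_assoc, L.weylOperator_mul_weylOperator_pow_three hgr, mul_one]

omit [CharZero K] [FiniteDimensional K M] in
/-- `primitiveSpace (−h) (−a) k = primitiveSpace (−h) a k` (`Ker (−a)^{k+1} = Ker a^{k+1}`). [folklore] -/
private theorem primitiveSpace_neg_neg_eq (a : Module.End K M) (k : ℕ) : primitiveSpace (-h) (-a) k = primitiveSpace (-h) a k := by
  rw [primitiveSpace, primitiveSpace, ker_neg_pow]

/-- **THE `ᶜΛ`-PRIMITIVE VECTORS ARE THE TOPS OF THE STRINGS: `primitiveSpace (−h) ᶜΛ k = eᵏP_{−k}`** — for the reversed Lefschetz pair `(−h, ᶜΛ)`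
the primitive subspace of type `k` (`(−h)`-degree `−k`, killed by `ᶜΛ^{k+1}`) is `w(P_{−k}) = eᵏP_{−k}`. [cite: Andre1996Motifs, §1.2 (p. 11: the
triplet (ᶜΛ, h, −L))] [cite: Beauville2010SL2, §5 (primitive = lowest weight)] [cite: LooijengaLunts1997, §1 (1.6) proof] -/
theorem primitiveSpace_neg_dual_eq_map_pow (L : HasLefschetzProperty h e) (hgr : IsZGrading h) (k : ℕ) :
    primitiveSpace (-h) (L.dual hgr) k = (primitiveSpace h e k).map (e ^ k) := by
  have h1 := map_primitiveSpace_conj (LinearEquiv.ofLinear (L.weylOperator hgr) (L.weylOperator hgr ^ 3) (L.weylOperator_mul_weylOperator_pow_three hgr)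
    (L.pow_three_mul_weylOperator hgr)) h e k
  rw [L.weylOperator_conj_h hgr, L.weylOperator_conj_e hgr, primitiveSpace_neg_neg_eq, LinearEquiv.ofLinear_toLinearMap] at h1
  rw [← h1]
  have h2 := L.map_weylOperator_map_pow_primitiveSpace hgr (Nat.zero_le k)
  rwa [pow_zero, Module.End.one_eq_id, Submodule.map_id, Nat.sub_zero] at h2

/-- **`eᵏP_{−k} = M_k ∩ Ker L`**: the tops of the strings of length `k + 1` are the vectors of weight `k` killed by `L` (the highest weight vectors).
[cite: LooijengaLunts1997, §1 (1.1), (1.6)] [cite: Beauville2010SL2, §5] -/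
theorem primitiveSpace_neg_dual_eq_degreeSpace_inf_ker (L : HasLefschetzProperty h e) (hgr : IsZGrading h) (k : ℕ) :
    primitiveSpace (-h) (L.dual hgr) k = degreeSpace h k ⊓ LinearMap.ker e := by
  rw [L.primitiveSpace_neg_dual_eq_map_pow hgr]
  apply le_antisymm
  · rintro _ ⟨p, hp, rfl⟩
    refine Submodule.mem_inf.2 ⟨?_, ?_⟩
    · have h1 := L.pow_apply_mem (mem_primitiveSpace_iff.1 hp).1 k
      rwa [show -(k : ℤ) + 2 * k = k by ring] at h1
    · rw [LinearMap.mem_ker, ← Module.End.mul_apply, ← pow_succ', (mem_primitiveSpace_iff.1 hp).2]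
  · intro x hx
    obtain ⟨hxk, hxe⟩ := Submodule.mem_inf.1 hx
    -- `x = eᵏy` with `y ∈ M_{−k}` (Lefschetz), and `e^{k+1}y = e x = 0`
    obtain ⟨y, hy, hyx⟩ := (L.bijOn_int (n := k) (by omega)).surjOn hxk
    rw [Int.toNat_natCast] at hyx
    refine ⟨y, mem_primitiveSpace_iff.2 ⟨hy, ?_⟩, hyx⟩
    rw [pow_succ', Module.End.mul_apply, hyx]
    exact LinearMap.mem_ker.1 hxe

end HasLefschetzProperty

end Literature.Algebra.Lie
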